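import Mathlib
import Summits.RiemannHypothesis.RiemannHypothesis.Theorems.WeilFarFloorCoshSplitRH
import HarnessLib

/-!
# Under RH, near-extremal regular window functions are close to the cosh profile (profile rigidity)

Helper file (`--supports stmt-RiemannHypothesis-0098`, lead-track anchor: Weil-positivity window ladder, format-C far bound),
pure proofs.  Seat rh-explicit-weil-1 gen12 (memo `run/shared/lean/pub/rh-explicit/rh-explicit-weil-1/FORMAT-K3.md` §13.3); corollary of
`WeilFarFloorCoshSplitRH`.

The split inequality of `FloorCoshSplit.primeShiftForm_add_le_of_RH_split` is AFFINE in the energy `m = (∫u·C_b)²/(b + sinh b)` of `u`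
along the cosh profile `C_b = cosh(·/2)·1_{[−b,b]}`, with slope `S = 2(b + sinh b) + (1 + 1/δ)A − 4(1 + δ)Ψ(t₀) ≍ e^b`.  Keeping the slope
instead of discarding it gives RIGIDITY (`offProfile_energy_mul_slope_le_of_RH`): under RH, for every real Weil test `u` on `[−b, b]`,

  `S · (∫u² − m) ≤ (2(b + sinh b) + (1 + 1/δ)A − K)·∫u² + B₀ − Q_b(u)`,

i.e. the squared `L²`-distance of `u` from the line spanned by the cosh profile (`∫ (u − (∫u·C_b/P)·C_b)² = ∫u² − m`,
`integral_sq_sub_profile_eq`) is at most the DEFICIT of `Q_b(u)` below the RH ceiling, divided by `S ≍ e^b`.  For the `e^{−a}`-envelopes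
of `ε`-near-extremals of the floor (whose small-scale budget `B₀` is `θ∫u²`) the deficit is `≤ (2β_F + ε + O(θ))∫u²` under RH, so their
off-profile energy is `O(e^{−b})·∫u²`: near-extremals themselves need not be close to the cosh profile (resonance, `WeilFarFloorConeResonance`
of gen11), but their ENVELOPES are.  Standard axioms only; RH enters as Mathlib's `RiemannHypothesis`.
-/

set_option linter.dupNamespace false
set_option autoImplicit false

noncomputable section

open MeasureTheory Set Filter
open scoped Real Topology

namespace Summit.RiemannHypothesis.RiemannHypothesis.Theorems.WeilFormatC

namespace FloorCoshSplit

open Literature.NumberTheory.LFunctions FloorSmoothing FloorCosh FloorEnvelope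

variable {b : ℝ}

/-- **The off-profile energy is a squared distance**: for bounded measurable `u`, `C` vanishing off `[−b, b]` with `∫C² = P > 0`,
`∫ (u − (∫u·C/P)·C)² = ∫u² − (∫u·C)²/P`. -/
theorem integral_sq_sub_profile_eq {u C : ℝ → ℝ} {Cu CC P : ℝ} (hu : Measurable u) (hCu : ∀ x, |u x| ≤ Cu)
    (hus : ∀ x, x ∉ Icc (-b) b → u x = 0) (hC : Measurable C) (hCC : ∀ x, |C x| ≤ CC)
    (hCs : ∀ x, x ∉ Icc (-b) b → C x = 0) (hP : ∫ x, C x ^ 2 = P) (hP0 : 0 < P) :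
    ∫ x, (u x - (∫ y, u y * C y) / P * C x) ^ 2 = (∫ x, u x ^ 2) - (∫ x, u x * C x) ^ 2 / P := by
  set c : ℝ := (∫ y, u y * C y) / P with hc
  have iuu : Integrable fun x ↦ u x ^ 2 := by
    have := integrable_shiftAdd_mul_shiftAdd hu hCu hus 0 0
    simp only [add_zero] at this
    exact this.congr (Eventually.of_forall fun y ↦ by simp only; ring)
  have iCC : Integrable fun x ↦ C x ^ 2 := by
    have := integrable_shiftAdd_mul_shiftAdd hC hCC hCs 0 0
    simp only [add_zero] at this
    exact this.congr (Eventually.of_forall fun y ↦ by simp only; ring)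
  have iuC : Integrable fun x ↦ u x * C x := by
    have := integrable_shift_mul_shift_two hu hC hCu hCC hCs 0 0
    simpa only [sub_zero] using this
  have e : ∀ x, (u x - c * C x) ^ 2 = u x ^ 2 - 2 * c * (u x * C x) + c ^ 2 * C x ^ 2 := fun x ↦ by ring
  simp_rw [e]
  rw [integral_add (f := fun x ↦ u x ^ 2 - 2 * c * (u x * C x)) (g := fun x ↦ c ^ 2 * C x ^ 2)
      (by exact iuu.sub (iuC.const_mul _)) (iCC.const_mul _),
    integral_sub (f := fun x ↦ u x ^ 2) (g := fun x ↦ 2 * c * (u x * C x)) iuu (iuC.const_mul _),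
    integral_const_mul, integral_const_mul, hP, hc]
  field_simp
  ring

/-- **PROFILE RIGIDITY UNDER RH.**  In the situation of `primeShiftForm_add_le_of_RH_split` (a real Weil test `u` on `[−b, b]`, `δ, t₀ > 0`,
small-scale budget `B₀`, cosh-profile budget `A` on `(t₀, ∞)`), with `S = 2(b + sinh b) + (1 + 1/δ)A − 4(1 + δ)Ψ(t₀)`:
`S·(∫u² − (∫u·C_b)²/(b + sinh b)) ≤ (2(b + sinh b) + (1 + 1/δ)A − (2I₀ + log 4π + γ))·∫u² + B₀ − Q_b(u)` —
the off-profile energy of `u` is controlled by the deficit of `Q_b(u)` below the RH ceiling. -/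
theorem offProfile_energy_mul_slope_le_of_RH (hRH : RiemannHypothesis) (hb : 0 < b) {u : ℝ → ℝ}
    (hu : IsWeilTest fun x ↦ (u x : ℂ)) (hus : tsupport (fun x ↦ (u x : ℂ)) ⊆ Icc (-b) b)
    {δ t₀ A B₀ : ℝ} (hδ : 0 < δ) (ht₀ : 0 < t₀)
    (hB₀ : ∫ t in Ioc 0 t₀, weilArchDensity t * ∫ x, (u (x + t) - u x) ^ 2 ≤ B₀)
    (hCint : IntegrableOn (fun t ↦ weilArchDensity t
        * ∫ x, ((Icc (-b) b).indicator (fun y ↦ Real.cosh (y / 2)) (x + t)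
            - (Icc (-b) b).indicator (fun y ↦ Real.cosh (y / 2)) x) ^ 2) (Ioi t₀))
    (hA : ∫ t in Ioi t₀, weilArchDensity t
        * ∫ x, ((Icc (-b) b).indicator (fun y ↦ Real.cosh (y / 2)) (x + t)
            - (Icc (-b) b).indicator (fun y ↦ Real.cosh (y / 2)) x) ^ 2 ≤ A * (b + Real.sinh b)) :
    (2 * (b + Real.sinh b) + (1 + 1 / δ) * A - 4 * (1 + δ) * weilArchTail t₀)
        * ((∫ x, u x ^ 2)
            - (∫ x, u x * (Icc (-b) b).indicator (fun y ↦ Real.cosh (y / 2)) x) ^ 2 / (b + Real.sinh b))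
      ≤ (2 * (b + Real.sinh b) + (1 + 1 / δ) * A
            - (2 * (∫ t in Ioi (0 : ℝ), (Real.exp (t / 2) - 1) / (2 * Real.sinh t))
                + (Real.log (4 * π) + Real.eulerMascheroniConstant))) * (∫ x, u x ^ 2)
        + B₀ - primeShiftForm b u := by
  have hkey := primeShiftForm_add_le_of_RH_split hRH hb hu hus hδ ht₀ hB₀ hCint hA
  linarith only [hkey]

/-- **Near-extremal regular functions are near the cosh line.**  If moreover the slope is positive and `Q_b(u)` is within `κ·∫u²` of the
RH ceiling, `(2(b + sinh b) + (1 + 1/δ)A − K − κ)·∫u² − B₀ ≤ Q_b(u)`, then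
`∫ (u − (∫u·C_b/P)·C_b)² ≤ (κ·∫u² + 2B₀)/S` (`P = b + sinh b`, `S = 2P + (1 + 1/δ)A − 4(1 + δ)Ψ(t₀)`). -/
theorem integral_sq_sub_profile_le_of_RH (hRH : RiemannHypothesis) (hb : 0 < b) {u : ℝ → ℝ}
    (hu : IsWeilTest fun x ↦ (u x : ℂ)) (hus : tsupport (fun x ↦ (u x : ℂ)) ⊆ Icc (-b) b)
    {δ t₀ A B₀ κ : ℝ} (hδ : 0 < δ) (ht₀ : 0 < t₀)
    (hS : 0 < 2 * (b + Real.sinh b) + (1 + 1 / δ) * A - 4 * (1 + δ) * weilArchTail t₀)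
    (hB₀ : ∫ t in Ioc 0 t₀, weilArchDensity t * ∫ x, (u (x + t) - u x) ^ 2 ≤ B₀)
    (hCint : IntegrableOn (fun t ↦ weilArchDensity t
        * ∫ x, ((Icc (-b) b).indicator (fun y ↦ Real.cosh (y / 2)) (x + t)
            - (Icc (-b) b).indicator (fun y ↦ Real.cosh (y / 2)) x) ^ 2) (Ioi t₀))
    (hA : ∫ t in Ioi t₀, weilArchDensity t
        * ∫ x, ((Icc (-b) b).indicator (fun y ↦ Real.cosh (y / 2)) (x + t)
            - (Icc (-b) b).indicator (fun y ↦ Real.cosh (y / 2)) x) ^ 2 ≤ A * (b + Real.sinh b))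
    (hnear : (2 * (b + Real.sinh b) + (1 + 1 / δ) * A
        - (2 * (∫ t in Ioi (0 : ℝ), (Real.exp (t / 2) - 1) / (2 * Real.sinh t))
            + (Real.log (4 * π) + Real.eulerMascheroniConstant)) - κ) * (∫ x, u x ^ 2) - B₀ ≤ primeShiftForm b u) :
    ∫ x, (u x - (∫ y, u y * (Icc (-b) b).indicator (fun z ↦ Real.cosh (z / 2)) y) / (b + Real.sinh b)
          * (Icc (-b) b).indicator (fun z ↦ Real.cosh (z / 2)) x) ^ 2
      ≤ (κ * (∫ x, u x ^ 2) + 2 * B₀) / (2 * (b + Real.sinh b) + (1 + 1 / δ) * A - 4 * (1 + δ) * weilArchTail t₀) := by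
  have hrig := offProfile_energy_mul_slope_le_of_RH hRH hb hu hus hδ ht₀ hB₀ hCint hA
  obtain ⟨hCm, hCb, hCs⟩ := coshTest_admissible b
  have hP0 : 0 < b + Real.sinh b := by have := Real.sinh_pos_iff.2 hb; linarith
  obtain ⟨-, hum, ⟨Cu, hCu⟩, hus0⟩ := weilTest_admissible hu hus
  rw [integral_sq_sub_profile_eq hum hCu hus0 hCm hCb hCs (integral_coshTest_sq hb.le) hP0, le_div_iff₀ hS]
  set S := 2 * (b + Real.sinh b) + (1 + 1 / δ) * A - 4 * (1 + δ) * weilArchTail t₀ with hSdef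
  set D := (∫ x, u x ^ 2) - (∫ x, u x * (Icc (-b) b).indicator (fun y ↦ Real.cosh (y / 2)) x) ^ 2 / (b + Real.sinh b)
  clear_value S D
  nlinarith only [hrig, hnear, hS]

end FloorCoshSplit

end Summit.RiemannHypothesis.RiemannHypothesis.Theorems.WeilFormatC
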